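import Mathlib.Analysis.SpecialFunctions.Pow.Real
import Mathlib.Algebra.BigOperators.Field
import Mathlib.MeasureTheory.Measure.WithDensity
import HarnessLib

/-!
# Rejection sampling (Aaronson–Arkhipov 2013, Lemma 5.7)

Family `quantum-advantage`; an ingredient (step "`X ∼ 𝒢 ↦ X ∼ 𝒮_{m,n}`" of the Hiding Lemma 5.8)
of the proof of AA13's Main Theorem (Thm. 1.3, vendored as the named fact
`gpeSolvableInFBPPRel_NP_of_uniformApproxBosonSampling` in `BosonSamplingHardness.lean`).
Source: S. Aaronson, A. Arkhipov, *The computational complexity of linear optics*, Theory of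
Computing 9 (2013) 143–252, Lemma 5.7 (Rejection Sampling), p. 190, proof pp. 190–191
(journal pagination).

Printed statement. Let `𝒟 = {p_x}` and `ℰ = {q_x}` be two distributions over a finite set `S`.
Suppose `ζ q_x / p_x` is polynomial-time computable from `x`, where `ζ` is a constant with
`|ζ − 1| ≤ δ`, and `q_x / p_x ≤ 1 + δ` for all `x ∈ S`. Then the algorithm `R` which on a sample
`x ∼ 𝒟` accepts with probability `ζ q_x / (p_x (1 + δ)²) ≤ 1` satisfies: (i) conditioned on `R`
accepting, `x` is distributed according to `ℰ`; (ii) `Pr[R rejects] = O(δ)` over `x ∼ 𝒟` and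
the coins of `R` (proof: `Pr[R rejects] = 1 − ζ/(1 + δ)²`).

This file proves the *probabilistic content* of the lemma for weights `p q : S → ℝ` (apply with
`p x = (𝒟 x).toReal` for `PMF`s): with the acceptance probability
`a_x = ζ q_x / ((1 + δ)² p_x)`,

* `rejectionSampling_accept_le_one`: `a_x ≤ 1` (so `a_x` is a probability; `0 ≤ a_x` is
  `rejectionSampling_accept_nonneg`);
* `rejectionSampling_joint_eq`: `p_x a_x = (ζ/(1 + δ)²) q_x` for every `x` — the joint weight of
  "sample `x` and accept" is proportional to `q_x`, which is (i);
* `rejectionSampling_accept_prob`: `∑_x p_x a_x = ζ/(1 + δ)²`, and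
  `rejectionSampling_reject_le`: `1 − ∑_x p_x a_x ≤ 3δ`, an explicit form of (ii).

AA13 apply the lemma (proof of Lemma 5.8, p. 191) with `S = ℂ^{n×n}` *continuous*, `p = p_𝒢`
and `q = p_𝒮` the probability density functions of the Gaussian ensemble `𝒢^{n×n}` and of the
truncated Haar measure `𝒮_{m,n}`, `q/p ≤ 1 + O(δ)` being the Haar-unitary hiding theorem
(Thm. 5.2) and `ζ = (1/π)^{n²}/c_{m,n}`, `|ζ − 1| = O(δ)` (Lemma 5.6), "`ζ · p_𝒮(X)/p_𝒢(X)` …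
clearly computable in polynomial time (to any desired precision) given `X`" (eq. (5.76)). The
section "Density form" proves the same two properties for densities `p q : S → ℝ` with respect
to an arbitrary reference measure `ν` on a measurable space `S` (Lebesgue integrals of
`ENNReal.ofReal`): `rejectionSampling_setLIntegral_joint_eq` (the mass of "draw `x ∼ p·ν`, land
in `A` and accept" is `(ζ/(1 + δ)²) · ∫_A q dν` for every set `A`, i.e. conditioned on accepting
`x ∼ q·ν`), `rejectionSampling_withDensity_accept_eq` (the same as an identity of measures),
`rejectionSampling_lintegral_accept_prob` (acceptance probability `ζ/(1 + δ)²` when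
`∫ q dν = 1`) and `rejectionSampling_lintegral_accept_ge` (it is `≥ 1 − 3δ`).

The computational clause ("`R` can be implemented in BPP given a polynomial-time algorithm for
`ζ q_x/p_x`") is about the machine model and is not formalised here. Design: the ratio
hypothesis is written multiplicatively, `q_x ≤ (1 + δ) p_x`, which is the printed `q_x/p_x ≤ 1 + δ`
for `p_x > 0` and forces `q_x = 0` where `p_x = 0` (where the printed ratio is undefined; there
`a_x = 0` by the division convention and all identities hold trivially).
-/

open Finset

namespace Literature.Computability.QuantumComplexity

variable {S : Type*}

/-- The acceptance probability of AA13's rejection sampler on the sample `x`: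
`a_x = ζ q_x / ((1 + δ)² p_x)`. (AA13 Lemma 5.7, proof, p. 190.) [cite: AaronsonArkhipovToC2013, Lemma 5.7 (p. 190)] -/
noncomputable def rejectionAcceptProb (p q : S → ℝ) (ζ δ : ℝ) (x : S) : ℝ :=
  ζ * q x / ((1 + δ) ^ 2 * p x)

/-- Unfolding lemma for `rejectionAcceptProb`. [folklore] -/
theorem rejectionAcceptProb_def (p q : S → ℝ) (ζ δ : ℝ) (x : S) :
    rejectionAcceptProb p q ζ δ x = ζ * q x / ((1 + δ) ^ 2 * p x) :=
  rfl

/-- The acceptance probability is non-negative (for non-negative weights, `ζ ≥ 0`, `δ ≥ 0`).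
[folklore] -/
theorem rejectionSampling_accept_nonneg {p q : S → ℝ} {ζ δ : ℝ} (hζ : 0 ≤ ζ) (hδ : 0 ≤ δ)
    (hp : ∀ x, 0 ≤ p x) (hq : ∀ x, 0 ≤ q x) (x : S) :
    0 ≤ rejectionAcceptProb p q ζ δ x := by
  unfold rejectionAcceptProb
  have h1 : 0 ≤ (1 + δ) ^ 2 * p x := mul_nonneg (by positivity) (hp x)
  exact div_nonneg (mul_nonneg hζ (hq x)) h1

/-- **`a_x ≤ 1`**: under `|ζ − 1| ≤ δ` and `q_x ≤ (1 + δ) p_x` the acceptance probability is at most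
`1` ("then accept with probability `ζ q_x/p_x/(1 + δ)² ≤ 1`", AA13 Lemma 5.7, proof, p. 190). [cite: AaronsonArkhipovToC2013, Lemma 5.7 (p. 190)] -/
theorem rejectionSampling_accept_le_one {p q : S → ℝ} {ζ δ : ℝ} (hδ : 0 ≤ δ)
    (hζ : |ζ - 1| ≤ δ) (hp : ∀ x, 0 ≤ p x) (hq : ∀ x, 0 ≤ q x)
    (hratio : ∀ x, q x ≤ (1 + δ) * p x) (x : S) :
    rejectionAcceptProb p q ζ δ x ≤ 1 := by
  unfold rejectionAcceptProb
  have hζle : ζ ≤ 1 + δ := by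
    have := (abs_le.mp hζ).2
    linarith
  rcases (hp x).eq_or_lt with hpx | hpx
  · -- `p x = 0`: the denominator vanishes, junk value `0 ≤ 1`
    rw [← hpx, mul_zero, div_zero]
    exact zero_le_one
  · have hden : 0 < (1 + δ) ^ 2 * p x := mul_pos (by positivity) hpx
    rw [div_le_one hden]
    calc ζ * q x ≤ (1 + δ) * q x := mul_le_mul_of_nonneg_right hζle (hq x)
      _ ≤ (1 + δ) * ((1 + δ) * p x) := mul_le_mul_of_nonneg_left (hratio x) (by linarith)
      _ = (1 + δ) ^ 2 * p x := by ring

/-- **Property (i), joint form**: the weight of "draw `x ∼ 𝒟` and accept" is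
`p_x a_x = (ζ/(1 + δ)²) · q_x`, proportional to `q_x` with a constant independent of `x`; hence,
conditioned on accepting, `x ∼ ℰ` ("Property (i) is immediate", AA13 Lemma 5.7, p. 191).
Where `p_x = 0` the ratio hypothesis forces `q_x = 0` and both sides vanish. [cite: AaronsonArkhipovToC2013, Lemma 5.7 (i) (pp. 190–191)] -/
theorem rejectionSampling_joint_eq {p q : S → ℝ} {ζ δ : ℝ} (hδ : 0 ≤ δ)
    (hp : ∀ x, 0 ≤ p x) (hq : ∀ x, 0 ≤ q x) (hratio : ∀ x, q x ≤ (1 + δ) * p x) (x : S) :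
    p x * rejectionAcceptProb p q ζ δ x = ζ / (1 + δ) ^ 2 * q x := by
  unfold rejectionAcceptProb
  rcases (hp x).eq_or_lt with hpx | hpx
  · have hqx : q x = 0 := le_antisymm (by simpa [← hpx] using hratio x) (hq x)
    rw [← hpx, hqx]
    simp
  · have h1 : (1 + δ) ^ 2 ≠ 0 := by positivity
    field_simp

/-- **Acceptance probability**: `∑_x p_x a_x = ζ/(1 + δ)²` when `∑_x q_x = 1` (AA13 Lemma 5.7,
proof, eqs. (5.72)–(5.74), p. 191). [cite: AaronsonArkhipovToC2013, Lemma 5.7, eqs. (5.72)–(5.74) (p. 191)] -/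
theorem rejectionSampling_accept_prob [Fintype S] {p q : S → ℝ} {ζ δ : ℝ} (hδ : 0 ≤ δ)
    (hp : ∀ x, 0 ≤ p x) (hq : ∀ x, 0 ≤ q x) (hratio : ∀ x, q x ≤ (1 + δ) * p x)
    (hqsum : ∑ x, q x = 1) :
    ∑ x, p x * rejectionAcceptProb p q ζ δ x = ζ / (1 + δ) ^ 2 := by
  simp_rw [rejectionSampling_joint_eq hδ hp hq hratio]
  rw [← Finset.mul_sum, hqsum, mul_one]

/-- **Property (ii), explicit**: the rejection probability `1 − ∑_x p_x a_x = 1 − ζ/(1 + δ)²` is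
at most `3δ` when `|ζ − 1| ≤ δ`, `0 ≤ δ` (AA13 Lemma 5.7 (ii): "`= O(δ)`", eq. (5.75), p. 191;
here `1 − (1 − δ)/(1 + δ)² ≤ 3δ` since `(1 + δ)²(1 − 3δ) ≤ 1 − δ`). [cite: AaronsonArkhipovToC2013, Lemma 5.7 (ii), eq. (5.75) (p. 191)] -/
theorem rejectionSampling_reject_le [Fintype S] {p q : S → ℝ} {ζ δ : ℝ} (hδ : 0 ≤ δ)
    (hζ : |ζ - 1| ≤ δ) (hp : ∀ x, 0 ≤ p x) (hq : ∀ x, 0 ≤ q x)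
    (hratio : ∀ x, q x ≤ (1 + δ) * p x) (hqsum : ∑ x, q x = 1) :
    1 - ∑ x, p x * rejectionAcceptProb p q ζ δ x ≤ 3 * δ := by
  rw [rejectionSampling_accept_prob hδ hp hq hratio hqsum]
  have hζge : 1 - δ ≤ ζ := by
    have := (abs_le.mp hζ).1
    linarith
  have hpos : 0 < (1 + δ) ^ 2 := by positivity
  -- `1 - 3δ ≤ (1 - δ)/(1+δ)² ≤ ζ/(1+δ)²`
  have key : (1 - 3 * δ) * (1 + δ) ^ 2 ≤ 1 - δ := by nlinarith [sq_nonneg δ, mul_nonneg hδ (sq_nonneg δ)]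
  have h2 : 1 - 3 * δ ≤ ζ / (1 + δ) ^ 2 := by
    rw [le_div_iff₀ hpos]
    linarith
  linarith

/-! ### The rejection bound as pure arithmetic -/

/-- The arithmetic behind property (ii): `1 − ζ/(1 + δ)² ≤ 3δ` whenever `|ζ − 1| ≤ δ`, `0 ≤ δ`
(AA13 Lemma 5.7, eq. (5.75): "`1 − ζ/(1 + δ)² = O(δ)`"; indeed `(1 + δ)²(1 − 3δ) ≤ 1 − δ ≤ ζ`).
[cite: AaronsonArkhipovToC2013, Lemma 5.7 (ii), eq. (5.75) (p. 191)] -/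
theorem rejectionSampling_one_sub_ratio_le {ζ δ : ℝ} (hδ : 0 ≤ δ) (hζ : |ζ - 1| ≤ δ) :
    1 - ζ / (1 + δ) ^ 2 ≤ 3 * δ := by
  have hζge : 1 - δ ≤ ζ := by
    have := (abs_le.mp hζ).1
    linarith
  have hpos : 0 < (1 + δ) ^ 2 := by positivity
  have key : (1 - 3 * δ) * (1 + δ) ^ 2 ≤ 1 - δ := by
    nlinarith [sq_nonneg δ, mul_nonneg hδ (sq_nonneg δ)]
  have h2 : 1 - 3 * δ ≤ ζ / (1 + δ) ^ 2 := by
    rw [le_div_iff₀ hpos]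
    linarith
  linarith

/-! ### Density form (continuous sample spaces)

AA13 use Lemma 5.7 for the densities `p_𝒢`, `p_𝒮` on `ℂ^{n×n}` (p. 191). The statements below
are the joint-weight identity (i) and the acceptance probability (ii) for densities
`p q : S → ℝ` with respect to a reference measure `ν` on a measurable space `S`, written with
Lebesgue integrals of `ENNReal.ofReal`; the acceptance probability on the sample `x` is the same
`rejectionAcceptProb p q ζ δ x = ζ q_x / ((1 + δ)² p_x) ∈ [0, 1]`
(`rejectionSampling_accept_nonneg`, `rejectionSampling_accept_le_one`). -/

section DensityForm

open MeasureTheory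

variable [MeasurableSpace S]

/-- **Property (i), density form**: drawing `x` from the law with density `p` (w.r.t. `ν`) and
accepting with probability `a_x = ζ q_x/((1 + δ)² p_x)`, the mass of "`x ∈ A` and accept" is
`∫_A p a dν = (ζ/(1 + δ)²) · ∫_A q dν` for every set `A` — proportional to the `q`-law with a
constant independent of `A`, so conditioned on accepting `x` has density `q` (AA13 Lemma 5.7 (i),
applied on p. 191 to `p = p_𝒢`, `q = p_𝒮` on `ℂ^{n×n}`). Pointwise this is
`rejectionSampling_joint_eq`; no measurability is needed.
[cite: AaronsonArkhipovToC2013, Lemma 5.7 (i) (pp. 190–191) with Lemma 5.8 proof (p. 191)] -/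
theorem rejectionSampling_setLIntegral_joint_eq (ν : Measure S) {p q : S → ℝ} {ζ δ : ℝ}
    (hδ : 0 ≤ δ) (hζ : 0 ≤ ζ) (hp : ∀ x, 0 ≤ p x) (hq : ∀ x, 0 ≤ q x)
    (hratio : ∀ x, q x ≤ (1 + δ) * p x) (A : Set S) :
    ∫⁻ x in A, ENNReal.ofReal (p x * rejectionAcceptProb p q ζ δ x) ∂ν =
      ENNReal.ofReal (ζ / (1 + δ) ^ 2) * ∫⁻ x in A, ENNReal.ofReal (q x) ∂ν := by
  have hpt : ∀ x, ENNReal.ofReal (p x * rejectionAcceptProb p q ζ δ x) =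
      ENNReal.ofReal (ζ / (1 + δ) ^ 2) * ENNReal.ofReal (q x) := fun x => by
    rw [rejectionSampling_joint_eq hδ hp hq hratio, ENNReal.ofReal_mul (by positivity)]
  simp_rw [hpt]
  rw [lintegral_const_mul' _ _ ENNReal.ofReal_ne_top]

/-- **Property (i) as an identity of measures**: the law of the accepted samples,
`(p · a) · ν`, is the constant multiple `(ζ/(1 + δ)²) · (q · ν)` of the target law
(AA13 Lemma 5.7 (i) with p. 191). [cite: AaronsonArkhipovToC2013, Lemma 5.7 (i) (pp. 190–191) with Lemma 5.8 proof (p. 191)] -/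
theorem rejectionSampling_withDensity_accept_eq (ν : Measure S) {p q : S → ℝ} {ζ δ : ℝ}
    (hδ : 0 ≤ δ) (hζ : 0 ≤ ζ) (hp : ∀ x, 0 ≤ p x) (hq : ∀ x, 0 ≤ q x)
    (hratio : ∀ x, q x ≤ (1 + δ) * p x) :
    ν.withDensity (fun x => ENNReal.ofReal (p x * rejectionAcceptProb p q ζ δ x)) =
      ENNReal.ofReal (ζ / (1 + δ) ^ 2) • ν.withDensity (fun x => ENNReal.ofReal (q x)) := by
  ext A hA
  rw [withDensity_apply _ hA, Measure.smul_apply, withDensity_apply _ hA, smul_eq_mul,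
    rejectionSampling_setLIntegral_joint_eq ν hδ hζ hp hq hratio A]

/-- **Acceptance probability, density form**: if `q` is a probability density
(`∫ q dν = 1`) then `∫ p a dν = ζ/(1 + δ)²` (AA13 Lemma 5.7, eqs. (5.72)–(5.74), for densities as
on p. 191). [cite: AaronsonArkhipovToC2013, Lemma 5.7, eqs. (5.72)–(5.74) (p. 191)] -/
theorem rejectionSampling_lintegral_accept_prob (ν : Measure S) {p q : S → ℝ} {ζ δ : ℝ}
    (hδ : 0 ≤ δ) (hζ : 0 ≤ ζ) (hp : ∀ x, 0 ≤ p x) (hq : ∀ x, 0 ≤ q x)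
    (hratio : ∀ x, q x ≤ (1 + δ) * p x) (hqint : ∫⁻ x, ENNReal.ofReal (q x) ∂ν = 1) :
    ∫⁻ x, ENNReal.ofReal (p x * rejectionAcceptProb p q ζ δ x) ∂ν =
      ENNReal.ofReal (ζ / (1 + δ) ^ 2) := by
  have h := rejectionSampling_setLIntegral_joint_eq ν hδ hζ hp hq hratio Set.univ
  rw [setLIntegral_univ, setLIntegral_univ] at h
  rw [h, hqint, mul_one]

/-- **Property (ii), density form**: the acceptance probability is at least `1 − 3δ`, i.e. the
sampler rejects with probability `≤ 3δ = O(δ)` (AA13 Lemma 5.7 (ii), eq. (5.75), for densities as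
on p. 191; `|ζ − 1| ≤ δ`). [cite: AaronsonArkhipovToC2013, Lemma 5.7 (ii), eq. (5.75) (p. 191)] -/
theorem rejectionSampling_lintegral_accept_ge (ν : Measure S) {p q : S → ℝ} {ζ δ : ℝ}
    (hδ : 0 ≤ δ) (hζ : |ζ - 1| ≤ δ) (hp : ∀ x, 0 ≤ p x) (hq : ∀ x, 0 ≤ q x)
    (hratio : ∀ x, q x ≤ (1 + δ) * p x) (hqint : ∫⁻ x, ENNReal.ofReal (q x) ∂ν = 1) :
    ENNReal.ofReal (1 - 3 * δ) ≤
      ∫⁻ x, ENNReal.ofReal (p x * rejectionAcceptProb p q ζ δ x) ∂ν := by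
  rcases le_or_gt (1 - 3 * δ) 0 with h3 | h3
  · rw [ENNReal.ofReal_of_nonpos h3]
    exact bot_le
  · have hζ0 : 0 ≤ ζ := by
      have := (abs_le.mp hζ).1
      linarith
    rw [rejectionSampling_lintegral_accept_prob ν hδ hζ0 hp hq hratio hqint]
    exact ENNReal.ofReal_le_ofReal (by linarith [rejectionSampling_one_sub_ratio_le hδ hζ])

end DensityForm

end Literature.Computability.QuantumComplexity
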